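import Summits.CriticalPhenomena.PercolationContinuityZ3.Theorems.Transplant.FKConnectivityAllQPat3VeeKRows
import Summits.CriticalPhenomena.PercolationContinuityZ3.Theorems.Transplant.FKConnectivityAllQPat3VeeLeaf
import Summits.CriticalPhenomena.PercolationContinuityZ3.Theorems.Transplant.FKConnectivityAllQPat3ShapeZeroK
import HarnessLib

/-!
# Connectivity correlation inequalities for `φ_{w,q}`, every `q > 0` — THE LEAF VEE\* IN ALL {free, contracted} STATES
# (census g41: the K-state form of census g40's `…Pat3VeeLeaf`, for THEOREM SP(W₄-free) in the (E, C)-minor form)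

Proof file (`--supports stmt-CriticalPhenomena-4575`), census lineage (gen 41) of LANE 2's FK sub-programme; builds on p205010 (kernel
theorem, internal audit signed; external expert review pending).  No definitions, no named facts, no sorries; standard axioms.

On the `K₄` skeleton `a b c d = p 0 … p 3` (injective names `p : Fin 6 → V`) with piece minors `(E₁, C₁)` in the slot `bc` (inner mark
`p 4`) and `(E₂, C₂)` in the slot `bd` (inner mark `p 5`), each carrying `famP11` levelwise nonnegative at its own `(u, v, m)`, and the
four plain slots `[ab, ac, ad, cd] = FK.skelVee` split into FREE `L` and CONTRACTED `K` (`(L, K) ∈ FK.splits FK.skelVee`): the SP-family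
`T_sym`, `STAR_x` (apex the vertex `a`), `STAR_x~` (apex the mark in `bc`), `STAR_s` (apex the mark in `bd`) is levelwise nonnegative
at `(a, p 4, p 5)` on the composite minor `(plainSet p L ∪ E₁ ∪ E₂, plainSet p K ∪ C₁ ∪ C₂)` —
**`FK.veeK_tsym_level_nonneg / veeK_starX_level_nonneg / veeK_starXm_level_nonneg / veeK_starS_level_nonneg`**
(`FK.shape2KC_nonneg_of_rows` + the bundled rows `…Pat3VeeKRows` of the 64 kernel-checked data files; `K = []` is census g40's
`FK.veeStar_*_level_nonneg`). [cite: AyyerLinussonRavichandran2025, §7 (p. 22)]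
-/

namespace Summit.CriticalPhenomena.PercolationContinuityZ3.Theorems

namespace FK

open SimpleGraph Literature.Probability.LatticeModels Literature.Probability.Percolation
open scoped Classical

variable {V : Type*}

section VeeLeafK

variable [Fintype V] {p : Fin 6 → V} {E₁ C₁ E₂ C₂ : Finset (Sym2 V)} {V₁ V₂ : Set V} {L K : List (Fin 6 × Fin 6)}

/-- The common engine call of the four K-state VEE\* leaves: a bundled rows fact for `F` gives `F ≥ 0` levelwise on the composite. [folklore] -/
theorem veeK_level_nonneg_of_rows (hinj : Function.Injective p) (hLK : (L, K) ∈ splits skelVee)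
    (hE1 : ∀ e ∈ (↑(E₁ ∪ C₁) : Set (Sym2 V)), ∀ z ∈ e, z ∈ V₁) (hE2 : ∀ e ∈ (↑(E₂ ∪ C₂) : Set (Sym2 V)), ∀ z ∈ e, z ∈ V₂)
    (hp1 : ∀ a, p a ∈ V₁ → p a = p 1 ∨ p a = p 2 ∨ p a = p 4) (hp2 : ∀ a, p a ∈ V₂ → p a = p 1 ∨ p a = p 3 ∨ p a = p 5)
    (h12 : ∀ z ∈ V₁, z ∈ V₂ → z = p 1 ∨ z = p 3) (hm1 : p 4 ∈ V₁) (hm2 : p 5 ∈ V₂)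
    (hd1 : Disjoint (plainSet p skelVee) E₁) (hd2 : Disjoint (plainSet p skelVee ∪ E₁) E₂)
    (hval1 : ∀ i ν, 0 ≤ lev2C E₁ C₁ (p 1) (p 2) (p 4) (famGet famP11 i) ν)
    (hval2 : ∀ i ν, 0 ≤ lev2C E₂ C₂ (p 1) (p 3) (p 5) (famGet famP11 i) ν) (F : ℕ → Pat3 → Pat3 → ℤ)
    (hrows : ∃ prods : List Prod2, ∃ Dn : ℕ, 0 < Dn ∧ (∃ cs : List (ℕ × ℕ × ℕ × ℕ), prods = cs.map (Prod2.ofIdx famP11orb)) ∧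
      ∀ (d : ℕ) (P1 Q1 P2 Q2 : Pat3), 4 * (prods.map fun q => (q.lam : ℤ) * q.tensor d P1 Q1 P2 Q2).sum ≤
        (Dn : ℤ) * symm4d (coefTab2K L K (1 : Fin 6) 2 4 1 3 5 0 4 5 F) d P1 Q1 P2 Q2) (μ : ℕ) :
    0 ≤ lev2C (plainSet p L ∪ E₁ ∪ E₂) (plainSet p K ∪ C₁ ∪ C₂) (p 0) (p 4) (p 5) F μ := by
  obtain ⟨prods, Dn, hDn, ⟨cs, rfl⟩, hr⟩ := hrows
  have hsub := plainSet_subset_of_splits (p := p) hLK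
  exact shape2KC_nonneg_of_rows hinj hE1 hE2 hp1 hp2 h12 hm1 hm2 (hinj.ne (by decide)) (hinj.ne (by decide)) rfl rfl rfl rfl rfl rfl
    (by decide) (by decide) rfl rfl rfl (splits_forall hLK (skelVee_ne hinj)).1 (splits_nodup_left hLK (skelVee_nodup hinj))
    (splits_forall hLK (skelVee_marks hinj)).1 (splits_forall hLK (skelVee_marks hinj)).2
    (Finset.disjoint_of_subset_left hsub hd1)
    (Finset.disjoint_of_subset_left (Finset.union_subset_union hsub le_rfl) hd2) F hDn hr
    (Prod2.ofIdx_nonneg (famGet_famP11orb_nonneg hval1) (famGet_famP11orb_nonneg hval2)) μ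

/-- **LEAF VEE\* × T_sym in every K-state.** [cite: AyyerLinussonRavichandran2025, §7 (p. 22)] -/
theorem veeK_tsym_level_nonneg (hinj : Function.Injective p) (hLK : (L, K) ∈ splits skelVee)
    (hE1 : ∀ e ∈ (↑(E₁ ∪ C₁) : Set (Sym2 V)), ∀ z ∈ e, z ∈ V₁) (hE2 : ∀ e ∈ (↑(E₂ ∪ C₂) : Set (Sym2 V)), ∀ z ∈ e, z ∈ V₂)
    (hp1 : ∀ a, p a ∈ V₁ → p a = p 1 ∨ p a = p 2 ∨ p a = p 4) (hp2 : ∀ a, p a ∈ V₂ → p a = p 1 ∨ p a = p 3 ∨ p a = p 5)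
    (h12 : ∀ z ∈ V₁, z ∈ V₂ → z = p 1 ∨ z = p 3) (hm1 : p 4 ∈ V₁) (hm2 : p 5 ∈ V₂)
    (hd1 : Disjoint (plainSet p skelVee) E₁) (hd2 : Disjoint (plainSet p skelVee ∪ E₁) E₂)
    (hval1 : ∀ i ν, 0 ≤ lev2C E₁ C₁ (p 1) (p 2) (p 4) (famGet famP11 i) ν)
    (hval2 : ∀ i ν, 0 ≤ lev2C E₂ C₂ (p 1) (p 3) (p 5) (famGet famP11 i) ν) (μ : ℕ) :
    0 ≤ lev2C (plainSet p L ∪ E₁ ∪ E₂) (plainSet p K ∪ C₁ ∪ C₂) (p 0) (p 4) (p 5) tsym2Tab μ :=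
  veeK_level_nonneg_of_rows hinj hLK hE1 hE2 hp1 hp2 h12 hm1 hm2 hd1 hd2 hval1 hval2 _ (veeK_tsym_rows (L, K) hLK) μ

/-- **LEAF VEE\* × STAR_x (apex the vertex `a`) in every K-state.** [cite: AyyerLinussonRavichandran2025, §7 (p. 22)] -/
theorem veeK_starX_level_nonneg (hinj : Function.Injective p) (hLK : (L, K) ∈ splits skelVee)
    (hE1 : ∀ e ∈ (↑(E₁ ∪ C₁) : Set (Sym2 V)), ∀ z ∈ e, z ∈ V₁) (hE2 : ∀ e ∈ (↑(E₂ ∪ C₂) : Set (Sym2 V)), ∀ z ∈ e, z ∈ V₂)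
    (hp1 : ∀ a, p a ∈ V₁ → p a = p 1 ∨ p a = p 2 ∨ p a = p 4) (hp2 : ∀ a, p a ∈ V₂ → p a = p 1 ∨ p a = p 3 ∨ p a = p 5)
    (h12 : ∀ z ∈ V₁, z ∈ V₂ → z = p 1 ∨ z = p 3) (hm1 : p 4 ∈ V₁) (hm2 : p 5 ∈ V₂)
    (hd1 : Disjoint (plainSet p skelVee) E₁) (hd2 : Disjoint (plainSet p skelVee ∪ E₁) E₂)
    (hval1 : ∀ i ν, 0 ≤ lev2C E₁ C₁ (p 1) (p 2) (p 4) (famGet famP11 i) ν)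
    (hval2 : ∀ i ν, 0 ≤ lev2C E₂ C₂ (p 1) (p 3) (p 5) (famGet famP11 i) ν) (μ : ℕ) :
    0 ≤ lev2C (plainSet p L ∪ E₁ ∪ E₂) (plainSet p K ∪ C₁ ∪ C₂) (p 0) (p 4) (p 5) starXTab μ :=
  veeK_level_nonneg_of_rows hinj hLK hE1 hE2 hp1 hp2 h12 hm1 hm2 hd1 hd2 hval1 hval2 _ (veeK_starX_rows (L, K) hLK) μ

/-- **LEAF VEE\* × STAR_x~ (apex the mark in the slot `bc`) in every K-state.** [cite: AyyerLinussonRavichandran2025, §7 (p. 22)] -/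
theorem veeK_starXm_level_nonneg (hinj : Function.Injective p) (hLK : (L, K) ∈ splits skelVee)
    (hE1 : ∀ e ∈ (↑(E₁ ∪ C₁) : Set (Sym2 V)), ∀ z ∈ e, z ∈ V₁) (hE2 : ∀ e ∈ (↑(E₂ ∪ C₂) : Set (Sym2 V)), ∀ z ∈ e, z ∈ V₂)
    (hp1 : ∀ a, p a ∈ V₁ → p a = p 1 ∨ p a = p 2 ∨ p a = p 4) (hp2 : ∀ a, p a ∈ V₂ → p a = p 1 ∨ p a = p 3 ∨ p a = p 5)
    (h12 : ∀ z ∈ V₁, z ∈ V₂ → z = p 1 ∨ z = p 3) (hm1 : p 4 ∈ V₁) (hm2 : p 5 ∈ V₂)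
    (hd1 : Disjoint (plainSet p skelVee) E₁) (hd2 : Disjoint (plainSet p skelVee ∪ E₁) E₂)
    (hval1 : ∀ i ν, 0 ≤ lev2C E₁ C₁ (p 1) (p 2) (p 4) (famGet famP11 i) ν)
    (hval2 : ∀ i ν, 0 ≤ lev2C E₂ C₂ (p 1) (p 3) (p 5) (famGet famP11 i) ν) (μ : ℕ) :
    0 ≤ lev2C (plainSet p L ∪ E₁ ∪ E₂) (plainSet p K ∪ C₁ ∪ C₂) (p 0) (p 4) (p 5) (mirror2 starXTab) μ :=
  veeK_level_nonneg_of_rows hinj hLK hE1 hE2 hp1 hp2 h12 hm1 hm2 hd1 hd2 hval1 hval2 _ (veeK_starXm_rows (L, K) hLK) μ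

/-- **LEAF VEE\* × STAR_s (apex the mark in the slot `bd`) in every K-state.** [cite: AyyerLinussonRavichandran2025, §7 (p. 22)] -/
theorem veeK_starS_level_nonneg (hinj : Function.Injective p) (hLK : (L, K) ∈ splits skelVee)
    (hE1 : ∀ e ∈ (↑(E₁ ∪ C₁) : Set (Sym2 V)), ∀ z ∈ e, z ∈ V₁) (hE2 : ∀ e ∈ (↑(E₂ ∪ C₂) : Set (Sym2 V)), ∀ z ∈ e, z ∈ V₂)
    (hp1 : ∀ a, p a ∈ V₁ → p a = p 1 ∨ p a = p 2 ∨ p a = p 4) (hp2 : ∀ a, p a ∈ V₂ → p a = p 1 ∨ p a = p 3 ∨ p a = p 5)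
    (h12 : ∀ z ∈ V₁, z ∈ V₂ → z = p 1 ∨ z = p 3) (hm1 : p 4 ∈ V₁) (hm2 : p 5 ∈ V₂)
    (hd1 : Disjoint (plainSet p skelVee) E₁) (hd2 : Disjoint (plainSet p skelVee ∪ E₁) E₂)
    (hval1 : ∀ i ν, 0 ≤ lev2C E₁ C₁ (p 1) (p 2) (p 4) (famGet famP11 i) ν)
    (hval2 : ∀ i ν, 0 ≤ lev2C E₂ C₂ (p 1) (p 3) (p 5) (famGet famP11 i) ν) (μ : ℕ) :
    0 ≤ lev2C (plainSet p L ∪ E₁ ∪ E₂) (plainSet p K ∪ C₁ ∪ C₂) (p 0) (p 4) (p 5) starSTab μ :=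
  veeK_level_nonneg_of_rows hinj hLK hE1 hE2 hp1 hp2 h12 hm1 hm2 hd1 hd2 hval1 hval2 _ (veeK_starS_rows (L, K) hLK) μ

end VeeLeafK

end FK

end Summit.CriticalPhenomena.PercolationContinuityZ3.Theorems
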